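import Literature.MathematicalPhysics.QuantumFieldTheory.Balaban1983to89.T3PolyakovCovariance
import Literature.MathematicalPhysics.QuantumFieldTheory.Balaban1983to89.T3ContinuumLaw
import HarnessLib

/-!
# `Balaban1983to89.T3OSLawNondegenerate` — rung R3, LAW FORM with NON-TRIVIALITY: under K1 ∧ K2 with small large-field mass the unique
# OS-positive, torus-covariant continuum loop law of `SU(2)` YM₃ on a three-torus exists and its Polyakov marginals are non-degenerate and non-Gaussian

CITATION HEADER (lean-in-tree rule).  Cell `ym3-torus` (HUMAN RULING D-0037, YM ladder rung R3), seat `ym3-torus-p2` gen 6 (HOME/IR-NODE.md §12; LAW3 and NT3 rows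
of §1).  Sources: A. Jaffe, E. Witten, *Quantum Yang–Mills theory* (Clay 2006) [JaffeWittenClay2006] §6.5 p. 11 (the existence of limits of expectations as
the programme; what OS reconstruction consumes) and §4 p. 6 (non-triviality); C. Borgs, E. Seiler, CMP **91** (1983) [BorgsSeiler1983] §III.1 (III.23) (the margin);
C. King, CMP **102** (1986) [King1986] Thm 3.4 (the transfer); S. Chatterjee in Friz et al. (eds.) 2019 [Chatterjee2019YMProbabilists] §6 p. 19.

WHAT IS PROVED.  `T3ContinuumLaw` packaged the rung on one torus as ONE law: `ContinuumYM3Torus F ℰ γ ⇔ ∃! ν, IsOSContinuumLaw3 F hE hγ ν` (weak limit of the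
loop laws ∧ uniqueness ∧ moments ∧ OS positivity on every strict cone ∧ `T₁ ⋊ B₃` invariance).  `T3TailTransferLower`/`T3PolyakovCovariance` reduced NT3 to
K1 ∧ K2 with small large-field mass.  Here the two are joined: **`exists_osLaw_polyakov_nondegenerate`** — for `SU(2)`, measurable `ℰ`, `γ ≥ 0`,
`UnitTiltTail F ℰ γ r w w'` with summable non-negative rates and `c + Σ(w + w') ≤ e^{−2Σr}/4`, `0 < c`: there is a law `ν` on `[-1,1]^{ULoop3 F}` with
`IsOSContinuumLaw3 F hE hγ ν`, UNIQUE with this property, such that for EVERY Polyakov label (any direction, any base point) `Var_ν(x_P) ≥ c` and the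
`P`-marginal of `ν` is not Gaussian; `existsUnique_osLaw_and_nontrivial` — the `∃!` form together with `LimitPointsNontrivial`.  WHAT THIS IS NOT: not a proof
of K1/K2 or of the mass smallness (a per-torus input, IR-NODE §12 (ii)/(iv′)); `exists_osLaw_polyakov_nondegenerate_SU` is the `SU(N)`, `N ≥ 3` twin (margin `1/(2N²)`).
-/

noncomputable section

open MeasureTheory Filter Topology ProbabilityTheory
open scoped NNReal
open Literature.MathematicalPhysics.QuantumFieldTheory.Balaban1983to89.T4Continuum
open Literature.MathematicalPhysics.QuantumFieldTheory.Balaban1983to89.T3ContinuumYM3Torus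
open Literature.MathematicalPhysics.QuantumFieldTheory.Balaban1983to89.T3UnitScaleTilt
open Literature.MathematicalPhysics.QuantumFieldTheory.Balaban1983to89.T3TailTransferLower
open Literature.MathematicalPhysics.QuantumFieldTheory.Balaban1983to89.T3PolyakovCovariance

namespace Literature.MathematicalPhysics.QuantumFieldTheory.Balaban1983to89.T3OSLawNondegenerate

variable {F : T3Family} {ℰ : LoopAverage (Matrix.specialUnitaryGroup (Fin 2) ℂ)} {γ : ℝ} {r w w' : ℕ → ℝ}

/-- **THE OS CONTINUUM LAW EXISTS, IS UNIQUE, AND HAS NON-DEGENERATE, NON-GAUSSIAN POLYAKOV MARGINALS** under K1 ∧ K2 with small large-field mass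
(`SU(2)`, measurable `ℰ`, `γ ≥ 0`; every Polyakov label `polyakov μ x`). [cite: JaffeWittenClay2006, §6.5 p.11] -/
theorem exists_osLaw_polyakov_nondegenerate (hE : ℰ.MeasurableE) (hγ : 0 ≤ γ) (h : UnitTiltTail F ℰ γ r w w') (hr : Summable r)
    (hw : Summable w) (hw' : Summable w') (hr0 : ∀ K, 0 ≤ r K) (hw0 : ∀ K, 0 ≤ w K) (hw0' : ∀ K, 0 ≤ w' K) (μ : Fin 3) (x : F.USite)
    {c : ℝ} (hc : 0 < c) (hsmall : c + ∑' i, (w i + w' i) ≤ Real.exp (-2 * ∑' i, r i) / 4) :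
    ∃ ν : ProbabilityMeasure (T4LimitLaw.Cube (ULoop3 F)), IsOSContinuumLaw3 F hE hγ ν ∧
      (∀ ν' : ProbabilityMeasure (T4LimitLaw.Cube (ULoop3 F)), IsOSContinuumLaw3 F hE hγ ν' → ν' = ν) ∧
      c ≤ Var[fun y => ((y (ULoop3.polyakov μ x) : Set.Icc (-1 : ℝ) 1) : ℝ); (ν : Measure (T4LimitLaw.Cube (ULoop3 F)))] ∧
      ∀ (m : ℝ) (v : ℝ≥0), (ν : Measure (T4LimitLaw.Cube (ULoop3 F))).map
        (fun y => ((y (ULoop3.polyakov μ x) : Set.Icc (-1 : ℝ) 1) : ℝ)) ≠ gaussianReal m v := by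
  have hV := uniformVariance_polyakov_of_smallMass_all hE hγ h hr hw hw' hr0 hw0 hw0' μ x hc hsmall
  obtain ⟨ν, hν, -, hvar, hng⟩ := limitLoopLaw_nondegenerate F hE hγ (hasContinuumLimit_of_unitTiltTail hE hγ hr hw hw' h) hV
  have hos : IsOSContinuumLaw3 F hE hγ ν := (isOSContinuumLaw3_iff_tendsto ν).mpr hν
  exact ⟨ν, hos, fun ν' hν' => hν'.unique hos, hvar, hng⟩

/-- **RUNG R3 IN LAW FORM PLUS NON-TRIVIALITY from K1 ∧ K2 with small large-field mass**: `(∃! ν, IsOSContinuumLaw3 F hE hγ ν) ∧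
LimitPointsNontrivial (F.scheme ℰ γ)` (`SU(2)`, measurable `ℰ`, `γ ≥ 0`, `Σ(w + w') < e^{−2Σr}/4`). [cite: JaffeWittenClay2006, §6.5 p.11] -/
theorem existsUnique_osLaw_and_nontrivial (hE : ℰ.MeasurableE) (hγ : 0 ≤ γ) (h : UnitTiltTail F ℰ γ r w w') (hr : Summable r)
    (hw : Summable w) (hw' : Summable w') (hr0 : ∀ K, 0 ≤ r K) (hw0 : ∀ K, 0 ≤ w K) (hw0' : ∀ K, 0 ≤ w' K)
    (hsmall : ∑' i, (w i + w' i) < Real.exp (-2 * ∑' i, r i) / 4) :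
    (∃! ν : ProbabilityMeasure (T4LimitLaw.Cube (ULoop3 F)), IsOSContinuumLaw3 F hE hγ ν) ∧ LimitPointsNontrivial (F.scheme ℰ γ) := by
  obtain ⟨hc3, hnt⟩ := continuumYM3Torus_nontrivial_of_smallMass hE hγ h hr hw hw' hr0 hw0 hw0' hsmall
  exact ⟨(continuumYM3Torus_iff_existsUnique_osLaw F hE hγ).mp hc3, hnt⟩

/-! ## `SU(N)`, `N ≥ 3` -/

section SUN

variable {N : ℕ} [NeZero N] {F' : T3Family} {ℰ' : LoopAverage (Matrix.specialUnitaryGroup (Fin N) ℂ)} {γ' : ℝ} {r' w₁ w₂ : ℕ → ℝ}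

/-- **The same for `SU(N)`, `N ≥ 3`** (margin `1/(2N²)`, tree `T3CentreSymmetrySUN`): under `UnitTiltTail` with summable non-negative rates and
`c + Σ(w + w') ≤ e^{−2Σr}/(2N²)`, `0 < c`, the OS continuum law exists, is unique, and every Polyakov marginal has variance `≥ c` and is not Gaussian. [cite: JaffeWittenClay2006, §6.5 p.11] -/
theorem exists_osLaw_polyakov_nondegenerate_SU (hN : 3 ≤ N) (hE : ℰ'.MeasurableE) (hγ : 0 ≤ γ') (h : UnitTiltTail F' ℰ' γ' r' w₁ w₂)
    (hr : Summable r') (hw : Summable w₁) (hw' : Summable w₂) (hr0 : ∀ K, 0 ≤ r' K) (hw0 : ∀ K, 0 ≤ w₁ K) (hw0' : ∀ K, 0 ≤ w₂ K)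
    (μ : Fin 3) (x : F'.USite) {c : ℝ} (hc : 0 < c)
    (hsmall : c + ∑' i, (w₁ i + w₂ i) ≤ Real.exp (-2 * ∑' i, r' i) / (2 * (N : ℝ) ^ 2)) :
    ∃ ν : ProbabilityMeasure (T4LimitLaw.Cube (ULoop3 F')), IsOSContinuumLaw3 F' hE hγ ν ∧
      (∀ ν' : ProbabilityMeasure (T4LimitLaw.Cube (ULoop3 F')), IsOSContinuumLaw3 F' hE hγ ν' → ν' = ν) ∧
      c ≤ Var[fun y => ((y (ULoop3.polyakov μ x) : Set.Icc (-1 : ℝ) 1) : ℝ); (ν : Measure (T4LimitLaw.Cube (ULoop3 F')))] ∧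
      ∀ (m : ℝ) (v : ℝ≥0), (ν : Measure (T4LimitLaw.Cube (ULoop3 F'))).map
        (fun y => ((y (ULoop3.polyakov μ x) : Set.Icc (-1 : ℝ) 1) : ℝ)) ≠ gaussianReal m v := by
  have hV := uniformVariance_polyakov_of_smallMass_SU_all hN hE hγ h hr hw hw' hr0 hw0 hw0' μ x hc hsmall
  obtain ⟨ν, hν, -, hvar, hng⟩ := limitLoopLaw_nondegenerate F' hE hγ (hasContinuumLimit_of_unitTiltTail hE hγ hr hw hw' h) hV
  have hos : IsOSContinuumLaw3 F' hE hγ ν := (isOSContinuumLaw3_iff_tendsto ν).mpr hν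
  exact ⟨ν, hos, fun ν' hν' => hν'.unique hos, hvar, hng⟩

end SUN

end Literature.MathematicalPhysics.QuantumFieldTheory.Balaban1983to89.T3OSLawNondegenerate

end
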